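import Summits.HodgeConjecture.HodgeConjecture.Theorems.F0LD2ThetaTensorCLM
import Literature.NumberTheory.Weil1964.ArchFollandTorusKType
import Literature.Analysis.SegalBargmann.HermiteExpansionSchwartz
import Literature.Analysis.SegalBargmann.HermiteOrthonormalEuclidean
import HarnessLib

set_option Elab.async false

/-!
# Crux `HLiu418`, line LD1 — (Gβ2-i′) THE HERMITE EXPANSION OF A THETA CLASS IN THE ARCHIMEDEAN FACTOR:
# `[Θ̃_{Φ_∞ ⊗ Φ_f}] = Σ_β c_β(Φ_∞) • [Θ̃_{h_β ⊗ Φ_f}]` IN `L²([U(H)], ν)` (THEOREMS ONLY)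

Cell hodgecm-mathlib, FLOOR 0, programme-6 line LD1 (socket `stub_S1_facts`, #73 E1θhol), LD1-p01 (g2), brick (Gβ2-i′) of LD1-plan's (I′) GERM
ROAD; `--supports stmt-HodgeConjecture-24832`.  Namespace `Summit.HodgeConjecture.HodgeConjecture.Cruxes.HLiu418.F0LD1ThetaClassHermiteSum`.
KERNEL ONLY: theorems; no definition, no named fact, no `sorry`, no instance, no notation.  Nothing of [Liu2021] is asserted; HC_CM is proved
only modulo the 7 printed citations (2 remaining: hLiu418 = stmt-HodgeConjecture-24832, h413 = stmt-HodgeConjecture-24833) until rung 0 closes;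
count-neutral.

THE POINT.  Along ANY Folland frame `e : X_∞ = (L⁺ ⊗ ℝ)^{n′} ≃L[ℝ] ℝ^σ` the Hermite functions `h_β = follandHermite e β ∈ 𝓢(X_∞)` (★
`ArchFollandTorusKType`) expand every archimedean test function IN THE SCHWARTZ TOPOLOGY: `Φ_∞ = Σ_β c_β(Φ_∞) h_β` with the Folland-frame Hermite
coefficients `c_β(Φ_∞) = hermiteCoeff β ((e_E^*)⁻¹ (e^* Φ_∞))` ([Folland1989, §1.7]; ★ `hasSum_hermiteCoeff_smul_hermitePi` transported by ★
`schwartzTransport e`).  Pushing this `HasSum` through the CONTINUOUS LINEAR archimedean slot ★ `F0LD2ThetaTensorCLM.exists_clm_toLp_lineThetaLift_tmul`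
(`Φ_∞ ↦ [Θ̃_{Φ_∞ ⊗ Φ_f}(f) ∘ ιA]`, [Weil1964, n° 41 Thm 6]) gives the expansion OF THE THETA CLASS in `L²([U(H)], ν)`:

* §1 `hasSum_follandCoeff_smul_follandHermite` — `HasSum (β ↦ c_β(Φ_∞) • h_β) Φ_∞` in `𝓢(X_∞)`; `follandCoeff_follandHermite` — `c_γ(h_β) = δ_{γβ}`;
* §2 **`hasSum_follandCoeff_smul_thetaClass_follandHermite`** — `HasSum (β ↦ c_β(Φ_∞) • [Θ̃_{h_β ⊗ Φ_f}]) [Θ̃_{Φ_∞ ⊗ Φ_f}]` in `L²([U(H)], ν)`, for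
  every `Φ_∞`, `Φ_f`, `μW`, `hρ`, abstract transport `ιA` (the class currency of LD1-plan 09:00:11Z: ★ kit `memLp_toQuotFun_lineThetaLift`,
  `piSchwartzBruhatEquiv … (Fin n') (φ ⊗ₜ Φf)`, weight `f`).

HONEST SCOPE.  Bookkeeping over ★ bricks; the coefficient is written INLINE (`hermiteCoeff β ((schwartzTransport (euclE σ)).symm (schwartzTransport e φ))`,
no new definition).  Nothing of [Liu2021] is asserted; no book row moves by this file alone.

## References
* [Folland1989] G. B. Folland, *Harmonic analysis in phase space*, Ann. Math. Stud. 122 (1989), §1.7 (1.81), Prop. (4.39).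
* [Weil1964] A. Weil, Acta Math. 111 (1964), Chap. III n° 41 Thm 6 p. 193.
* [BorelJacquet1979] A. Borel, H. Jacquet, PSPM 33.1 (1979), §4.6.
-/

set_option autoImplicit false
-- the mandated namespace has the single-problem summit's repeated segment (`HodgeConjecture.HodgeConjecture`)
set_option linter.dupNamespace false

noncomputable section

open NumberField NumberField.InfinitePlace NumberField.mixedEmbedding MeasureTheory IsDedekindDomain
open scoped Matrix Kronecker ComplexOrder ENNReal TensorProduct SchwartzMap Classical
open Literature.NumberTheory.Automorphic Literature.NumberTheory.Automorphic.UnitaryGroup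
open Literature.NumberTheory.Automorphic.UnitaryGroup.CotangentForms
open Literature.NumberTheory.Automorphic.IdeleClassGroup
open Literature.NumberTheory.Automorphic.Liu2021
open Literature.NumberTheory.Automorphic.Liu2021.Def411WeilCarriers
open Literature.NumberTheory.Automorphic.Liu2021.Def411WeilCarriersDoubling
open Literature.NumberTheory.GelbartRogawski1991 Literature.NumberTheory.GelbartRogawski1991.UnitaryDualPair
open Literature.NumberTheory.Weil1964
open Literature.RepresentationTheory.Liu2021
open Literature.RepresentationTheory.CompactGroups
open Literature.RepresentationTheory.HeisenbergGroup
open Literature.Analysis.SegalBargmann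

namespace Summit.HodgeConjecture.HodgeConjecture.Cruxes.HLiu418.F0LD1ThetaClassHermiteSum

/-! ## §1 The Hermite expansion along a Folland frame, in the Schwartz topology -/

section Frame

variable {σ : Type*} [Fintype σ] [DecidableEq σ] {D : Type*} [NormedAddCommGroup D] [NormedSpace ℝ D]

/-- **Hermite expansion along a Folland frame** `e : D ≃L[ℝ] ℝ^σ`: `φ = Σ_β c_β(φ) • follandHermite e β` IN `𝓢(D, ℂ)`, with
`c_β(φ) = hermiteCoeff β ((e_E^*)⁻¹ (e^* φ))` (★ `hasSum_hermiteCoeff_smul_hermitePi` transported by `(schwartzTransport e)⁻¹`).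
[cite: Folland1989, §1.7 (1.81)] -/
theorem hasSum_follandCoeff_smul_follandHermite (e : D ≃L[ℝ] (σ → ℝ)) (φ : 𝓢(D, ℂ)) :
    HasSum (fun β : σ →₀ ℕ =>
      hermiteCoeff β ((schwartzTransport (euclE σ)).symm (schwartzTransport e φ)) • follandHermite e β) φ := by
  have h := (hasSum_hermiteCoeff_smul_hermitePi (schwartzTransport e φ)).mapL
    ((schwartzTransport e).symm : 𝓢((σ → ℝ), ℂ) →L[ℂ] 𝓢(D, ℂ))
  simpa only [ContinuousLinearEquiv.coe_coe, map_smul, ContinuousLinearEquiv.symm_apply_apply, follandHermite] using h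

/-- **The Folland-frame coefficients of the Hermite functions**: `c_γ(follandHermite e β) = δ_{γβ}`. [cite: Folland1989, §1.7] -/
theorem follandCoeff_follandHermite (e : D ≃L[ℝ] (σ → ℝ)) (γ β : σ →₀ ℕ) :
    hermiteCoeff γ ((schwartzTransport (euclE σ)).symm (schwartzTransport e (follandHermite e β))) = if γ = β then 1 else 0 := by
  rw [schwartzTransport_follandHermite, hermitePi, ContinuousLinearEquiv.symm_apply_apply, hermiteCoeff_herm]

end Frame

/-! ## §2 The Hermite expansion of the theta class of a pure tensor -/

section Theta

variable (L : Type) [Field L] [NumberField L] [IsCMField L] (N : ℕ) (H : Matrix (Fin N) (Fin N) L)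
  {n' : ℕ} (e₁ : Fin N × Fin 1 ≃ Fin n') (dV : Fin N → L) (hdV : ∀ i, IsCMField.complexConj L (dV i) = dV i)
  (hdV0 : ∀ i, dV i ≠ 0)
  (ιA : (adelicGroupData (↥(maximalRealSubfield L)) L (IsCMField.complexConj L) N H).Adelic →* ↥(UnitaryGroup.adelic (↥(maximalRealSubfield L)) L (IsCMField.complexConj L) N (Matrix.diagonal dV)))
  (hιA : Continuous ιA ∧ ∀ ⦃γ : (adelicGroupData (↥(maximalRealSubfield L)) L (IsCMField.complexConj L) N H).Adelic⦄,
    γ ∈ (UnitaryGroup.toAdelic (↥(maximalRealSubfield L)) L (IsCMField.complexConj L) N H).range →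
      ιA γ ∈ (UnitaryGroup.toAdelic (↥(maximalRealSubfield L)) L (IsCMField.complexConj L) N (Matrix.diagonal dV)).range)
  (μ : Literature.NumberTheory.Automorphic.IdeleClassGroup L →ₜ* Circle) (hμ : IsConjugateSymplectic L μ) (a : (↥(maximalRealSubfield L))ˣ)
  (hρ : HasThetaMajorants fun
      (p : ↥(UnitaryGroup.adelic (↥(maximalRealSubfield L)) L (IsCMField.complexConj L) N (Matrix.diagonal dV)) × ↥(UnitaryGroup.adelic (↥(maximalRealSubfield L)) L (IsCMField.complexConj L) 1 (JW (↥(maximalRealSubfield L)) L a))) (Φ : piSchwartzBruhat (↥(maximalRealSubfield L)) (Fin n')) =>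
        pairRep (↥(maximalRealSubfield L)) L (IsCMField.complexConj L) N 1 e₁ (Matrix.diagonal dV) (JW (↥(maximalRealSubfield L)) L a)
          (chiSplittingLine L e₁ dV hdV hdV0 (toHeckeCharacter L μ) (isUnitary_toHeckeCharacter L μ)
            ((isOscillatorChar_toHeckeCharacter_iff μ).mpr hμ) (TW (↥(maximalRealSubfield L)) a)
            (isUnit_det_TW (↥(maximalRealSubfield L)) a) (JW (↥(maximalRealSubfield L)) L a) (JW_eq (↥(maximalRealSubfield L)) L a))
          p Φ)
  [CompactSpace (↥(UnitaryGroup.adelic (↥(maximalRealSubfield L)) L (IsCMField.complexConj L) N (Matrix.diagonal dV)) ⧸ (UnitaryGroup.toAdelic (↥(maximalRealSubfield L)) L (IsCMField.complexConj L) N (Matrix.diagonal dV)).range)] [MeasurableSpace (↥(UnitaryGroup.adelic (↥(maximalRealSubfield L)) L (IsCMField.complexConj L) 1 (JW (↥(maximalRealSubfield L)) L a)) ⧸ (UnitaryGroup.toAdelic (↥(maximalRealSubfield L)) L (IsCMField.complexConj L) 1 (JW (↥(maximalRealSubfield L)) L a)).range)] (μW : Measure (↥(UnitaryGroup.adelic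 (↥(maximalRealSubfield L)) L (IsCMField.complexConj L) 1 (JW (↥(maximalRealSubfield L)) L a)) ⧸ (UnitaryGroup.toAdelic (↥(maximalRealSubfield L)) L (IsCMField.complexConj L) 1 (JW (↥(maximalRealSubfield L)) L a)).range))
  (f : C((↥(UnitaryGroup.adelic (↥(maximalRealSubfield L)) L (IsCMField.complexConj L) 1 (JW (↥(maximalRealSubfield L)) L a)) ⧸ (UnitaryGroup.toAdelic (↥(maximalRealSubfield L)) L (IsCMField.complexConj L) 1 (JW (↥(maximalRealSubfield L)) L a)).range), ℂ))

include hιA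

variable [BorelSpace (↥(UnitaryGroup.adelic (↥(maximalRealSubfield L)) L (IsCMField.complexConj L) 1 (JW (↥(maximalRealSubfield L)) L a)) ⧸ (UnitaryGroup.toAdelic (↥(maximalRealSubfield L)) L (IsCMField.complexConj L) 1 (JW (↥(maximalRealSubfield L)) L a)).range)] [IsFiniteMeasure μW]
  [CompactSpace (adelicGroupData (↥(maximalRealSubfield L)) L (IsCMField.complexConj L) N H).automorphicQuotient]
  (ν : Measure (adelicGroupData (↥(maximalRealSubfield L)) L (IsCMField.complexConj L) N H).automorphicQuotient) [IsFiniteMeasure ν]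

include hιA in
/-- **(Gβ2-i′) Hermite expansion of the theta class in the archimedean factor**: along any Folland frame `e` of `X_∞`,
`HasSum (β ↦ c_β(Φ_∞) • [Θ̃_{h_β ⊗ Φ_f}(f) ∘ ιA]) [Θ̃_{Φ_∞ ⊗ Φ_f}(f) ∘ ιA]` in `L²([U(H)], ν)` (§1 pushed through the continuous linear slot ★
`exists_clm_toLp_lineThetaLift_tmul`, `HasSum.mapL`). [cite: Folland1989, §1.7 (1.81)] [cite: Weil1964, Chap. III n° 41 Thm 6 p. 193] -/
theorem hasSum_follandCoeff_smul_thetaClass_follandHermite {σ : Type*} [Fintype σ] [DecidableEq σ]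
    (e : (Fin n' → mixedEmbedding.mixedSpace ↥(maximalRealSubfield L)) ≃L[ℝ] (σ → ℝ))
    (Φf : FinSB (↥(maximalRealSubfield L)) (Fin n')) (φ : 𝓢((Fin n' → mixedEmbedding.mixedSpace ↥(maximalRealSubfield L)), ℂ)) :
    HasSum (fun β : σ →₀ ℕ =>
        hermiteCoeff β ((schwartzTransport (euclE σ)).symm (schwartzTransport e φ)) •
          MemLp.toLp _ (F0LD1ThetaTransportKit.memLp_toQuotFun_lineThetaLift L N H e₁ dV hdV hdV0 ιA hιA μ hμ a hρ μW
            (piSchwartzBruhatEquiv (↥(maximalRealSubfield L)) (Fin n') (follandHermite e β ⊗ₜ[ℂ] Φf)) f ν 2))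
      (MemLp.toLp _ (F0LD1ThetaTransportKit.memLp_toQuotFun_lineThetaLift L N H e₁ dV hdV hdV0 ιA hιA μ hμ a hρ μW
            (piSchwartzBruhatEquiv (↥(maximalRealSubfield L)) (Fin n') (φ ⊗ₜ[ℂ] Φf)) f ν 2)) := by
  obtain ⟨T, hT⟩ := F0LD2ThetaTensorCLM.exists_clm_toLp_lineThetaLift_tmul L N H e₁ dV hdV hdV0 ιA hιA μ hμ a hρ μW f ν Φf
  have h := (hasSum_follandCoeff_smul_follandHermite e φ).mapL T
  simp only [ContinuousLinearMap.map_smul] at h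
  simpa only [hT] using h

end Theta

end Summit.HodgeConjecture.HodgeConjecture.Cruxes.HLiu418.F0LD1ThetaClassHermiteSum

end
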